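import Literature.NumberTheory.EllipticCurves.HasseWeilAbelianConductorSwanIndependenceTwoProofs
import Literature.NumberTheory.EllipticCurves.SwanConductorTorsionDichotomyProofs
import Literature.NumberTheory.EllipticCurves.QuadraticTwistTameTorsionSwanProofs
import HarnessLib

/-!
# The wild conductor of the Mordell curves `y² = x³ + k`: `Sw_𝔓(V_ℓ E) = 2 · vol {u : Γ^u moves √k}`,
# at `2` over `ℚ` equal to `0, 2, 4`

`Proofs` file (theorems only, no definitions, no named facts) in topic
`NumberTheory/EllipticCurves`, landed by the seat of bsd.S15
(`Literature.NumberTheory.EllipticCurves.conductorNorm_eq_artinConductorNat`) as the **Galois side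
of Ogg's formula at `2` for the curves of invariant `j = 0`** over `ℚ` — a sub-family of the one
remaining leaf of Ogg–Saito over `ℚ` (additive, potentially good reduction at `2` with
`ord₂(j) > 0`; `OggFormulaPotGoodOrdinaryTwoProofs`).

Let `E : y² = x³ + k` (`a₁ = a₂ = a₃ = a₄ = 0`, `a₆ = k ≠ 0`) over a field with `2 ≠ 0`, and
`s = √k`.  The points `(0, ±s)` are the non-zero points of a cyclic subgroup of order `3` of `E`
(horizontal tangent: `2(0, s) = (0, -s)`), and `σ(0, s) = (0, σs)`.  Hence, over a number field
and at a prime `𝔓 ∤ 3`, a wild ramification group `Γ_K^u(𝔓)` (`u > 0`) fixes `E[3]` pointwise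
**iff it fixes `√k`**: one direction is the point `(0, s)`, the other the dichotomy of
`SwanConductorTorsionDichotomyProofs` (a wild ramification group fixing one non-zero point of
`E[3]` fixes `E[3]`, from `det ρ̄₃ = χ̄₃` and the `p`-group structure; Silverman *ATAEC* p. 370).
With `Sw_𝔓(V_ℓ E) = 2 · vol {u > 0 : Γ^u moves E[ℓ]}`
(`swanConductorAt_rationalTate_eq_two_mul_volume`) and the independence of `ℓ`
(`swanConductorAt_rationalTate_eq_swanConductorAt_rationalTate`, Thm. IV.10.2(c)):

* `exists_geomPoints_three_torsion_of_sq_eq` — the point `(0, s)`: non-zero, `3`-torsion,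
  `σ`-fixed iff `σs = s`;
* `forall_smul_geomTorsion_three_eq_iff_of_sq_eq` — `Γ_K^u(𝔓)` fixes `E[3]` iff it fixes `s`;
* `swanConductorAt_rationalTate_three_eq_two_mul_volume_of_sq_eq`,
  `swanConductorAt_rationalTate_eq_two_mul_volume_of_sq_eq` —
  **`Sw_𝔓(V_ℓ E) = 2 · vol {u > 0 : Γ_K^u(𝔓) moves √k}`** (`𝔓 ∣ v ∤ 3ℓ`): the wild conductor of a
  Mordell curve is twice the upper break of `K(√k)`, `δ(E) = 2δ(χ_k)` — although `E` is in
  general *not* a quadratic twist of a tame curve by `χ_k` alone (it is the twist by `1/k` of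
  `y² = x³ + k⁴`, which has the rational `3`-torsion point `(0, k²)`);
* over `ℚ` above `2`, writing `k = c²k₀` (`c ∈ ℚ^×`, `k₀ ∈ ℤ`):
  `swanConductorAt_rationalTate_eq_two_mul_volume_of_a₆_eq_sq_mul` and its evaluations
  **`Sw₂(V_ℓ E) = 0, 2, 4` for `k₀ ≡ 1, 3, 2 (mod 4)`**
  (`…_eq_zero_of_…_emod_four_eq_one`, `…_eq_two_of_…_emod_four_eq_three`,
  `…_eq_four_of_…_emod_four_eq_two`), by the breaks `0, 1, 2` of `ℚ₂(√k₀)`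
  (`QuadraticTwistTameTorsionSwanProofs`, `SqrtUpperRamificationProofs`).

Ogg's formula predicts accordingly `f₂ ∈ {2, 4, 6}` for the additive Mordell curves over `ℚ`
(e.g. `y² = x³ + 1`: `36 = 2²·3²`; `y² = x³ - 1`: `144 = 2⁴·3²`; `y² = x³ + 2`: `1728 = 2⁶·3³`);
the discriminant side (Tate's algorithm on `(0, 0, 0, 0, 2^a u)`, `a ≤ 5`: types II, IV, I₀*, IV*,
II*) is the next file of this seat.

## References

* J. H. Silverman, *Advanced Topics in the Arithmetic of Elliptic Curves*, GTM 151 (1994), §IV.10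
  (Definition of `δ`, PDF p. 358; Thm. 10.2(c)), §IV.11 (proof of Thm. 11.1 for `p = 3`, p. 370;
  `p = 2`, p. 366). [SilvermanATAEC1994]
* J. H. Silverman, *The Arithmetic of Elliptic Curves*, 2nd ed. (2009), III.2.3 (group law),
  X.6 (the curves `y² = x³ + D`). [SilvermanAEC2009]
* J.-P. Serre, *Local Fields*, GTM 67 (1979), Ch. IV §3, Ch. VI §2. [SerreLocalFields1979]
* J.-P. Serre, J. Tate, *Good reduction of abelian varieties*, Ann. of Math. 88 (1968), §3.
  [SerreTate1968]

## Design

Theorems only; `noncomputable section`; one universe `u`; everything in `namespace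
WeierstrassCurve`.  The curve is any `W` with `a₁ = a₂ = a₃ = a₄ = 0` (hypotheses, no
definition); the point `(0, s)` is Mathlib's `WeierstrassCurve.Affine.Point.some` on
`W.baseChange F̄` (`geomPoints W`), its order computed with `add_self_of_Y_ne`.  Over `ℚ` the
square root is `c · geomSqrt k₀` with `c` cast through `Rat.cast` (avoiding the two `ℚ`-algebra
structures on `ar ℚ`).  Axioms: `propext`, `Classical.choice`, `Quot.sound`.
-/

noncomputable section

open scoped Classical NumberField
open IsDedekindDomain Field Literature.NumberTheory.EllipticCurves
  Literature.NumberTheory.GaloisRepresentations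

universe u

namespace WeierstrassCurve

/-! ## §1. The `3`-torsion points `(0, ±√k)` of `y² = x³ + k` -/

section AnyField

variable {F : Type u} [Field F] (W : WeierstrassCurve F)

/-- **`(0, √k)` is a point of order `3` on `y² = x³ + k`, moved by `σ` exactly when `√k` is.**
Let `W = (0, 0, 0, 0, k)` over a field `F` with `2 ≠ 0`, and `s ∈ F̄` with `s² = k ≠ 0`.  Then
`P = (0, s) ∈ E(F̄)` is a non-zero point with `3P = O` (the tangent at `P` is horizontal:
`2P = (0, -s) = -P`, Silverman *AEC* III.2.3), and `σP = (0, σs)` for `σ ∈ Γ_F`, so `σP = P`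
iff `σs = s`.  (The inflection points `x = 0` of the Fermat-type cubic; *AEC* Exercise 10.19 /
the curves `y² = x³ + D` of X.6.)
[cite: SilvermanAEC2009, III.2.3 (group law algorithm) and X.6 (the curves y² = x³ + D)] -/
theorem exists_geomPoints_three_torsion_of_sq_eq (h₁ : W.a₁ = 0) (h₂ : W.a₂ = 0) (h₃ : W.a₃ = 0)
    (h₄ : W.a₄ = 0) (h2 : (2 : F) ≠ 0) {s : AlgebraicClosure F}
    (hs : s ^ 2 = algebraMap F (AlgebraicClosure F) W.a₆) (hs0 : s ≠ 0) :
    ∃ P : geomPoints W, P ≠ 0 ∧ (3 : ℕ) • P = 0 ∧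
      ∀ σ : absoluteGaloisGroup F, σ • P = P ↔ σ • s = s := by
  set E := (W.baseChange (AlgebraicClosure F)).toAffine with hE
  have hEa₁ : E.a₁ = 0 := by rw [hE]; simp [h₁]
  have hEa₂ : E.a₂ = 0 := by rw [hE]; simp [h₂]
  have hEa₃ : E.a₃ = 0 := by rw [hE]; simp [h₃]
  have hEa₄ : E.a₄ = 0 := by rw [hE]; simp [h₄]
  have hEa₆ : E.a₆ = algebraMap F (AlgebraicClosure F) W.a₆ := by rw [hE]; simp
  have h2L : (2 : AlgebraicClosure F) ≠ 0 := by
    rw [show (2 : AlgebraicClosure F) = algebraMap F (AlgebraicClosure F) 2 from (map_ofNat _ 2).symm]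
    exact (map_ne_zero _).mpr h2
  -- the points `(0, ±s)`
  have hns : ∀ t : AlgebraicClosure F, t ^ 2 = algebraMap F (AlgebraicClosure F) W.a₆ → t ≠ 0 → E.Nonsingular 0 t := by
    intro t ht ht0
    rw [Affine.nonsingular_iff, Affine.equation_iff, hEa₁, hEa₂, hEa₃, hEa₄, hEa₆]
    refine ⟨by rw [← ht]; ring, Or.inr ?_⟩
    intro h
    apply ht0
    have : (2 : AlgebraicClosure F) * t = 0 := by linear_combination h
    exact (mul_eq_zero.mp this).resolve_left h2L
  have hneg : ∀ t : AlgebraicClosure F, E.negY 0 t = -t := fun t ↦ by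
    rw [Affine.negY, hEa₁, hEa₃]; ring
  set P : E.Point := Affine.Point.some 0 s (hns s hs hs0) with hP
  -- `2P = -P`
  have h2P : P + P = -P := by
    have hy : s ≠ E.negY 0 s := by
      rw [hneg]; intro h
      apply hs0
      have : (2 : AlgebraicClosure F) * s = 0 := by linear_combination h
      exact (mul_eq_zero.mp this).resolve_left h2L
    rw [hP, Affine.Point.add_self_of_Y_ne hy, Affine.Point.neg_some]
    have hslope : E.slope 0 0 s s = 0 := by
      rw [Affine.slope_of_Y_ne rfl hy, hEa₁, hEa₂, hEa₄]; ring
    congr 1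
    · simp only [Affine.addX, hslope, hEa₁, hEa₂]; ring
    · simp only [Affine.addY, Affine.negAddY, Affine.addX, hslope, hEa₁, hEa₂, Affine.negY,
        hEa₃]
      ring
  refine ⟨(P : geomPoints W), Affine.Point.some_ne_zero _, ?_, fun σ ↦ ?_⟩
  · change (3 : ℕ) • P = 0
    rw [succ_nsmul, two_nsmul, h2P, neg_add_cancel]
  · change Affine.Point.map ((absoluteGaloisGroup.toAlgEquiv F σ :
        AlgebraicClosure F ≃ₐ[F] AlgebraicClosure F) : AlgebraicClosure F →ₐ[F] AlgebraicClosure F) P =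
      P ↔ _
    rw [hP, Affine.Point.map_some]
    constructor
    · intro h
      have := (Affine.Point.some.injEq _ _ _ _ _ _).mp h
      exact this.2
    · intro h
      congr 1
      exact map_zero _

end AnyField

/-! ## §2. Over a number field: `Γ^u` fixes `E[3]` iff it fixes `√k`; `Sw_𝔓(V_ℓ E) = 2·vol` -/

section NumberField

variable {K : Type u} [Field K] [NumberField K] (W : WeierstrassCurve K)

/-- **For `y² = x³ + k` over a number field, a wild ramification group `Γ_K^u(𝔓)` (`u > 0`,
`𝔓 ∤ 3`) fixes `E[3]` pointwise iff it fixes `√k`.**  If it fixes `E[3]` it fixes the point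
`(0, √k)` of order `3`; conversely, if it fixes `√k` it fixes that non-zero `3`-torsion point, hence
all of `E[3]` — a wild ramification group fixing one non-zero point of `E[ℓ]` fixes `E[ℓ]`
(`forall_smul_geomTorsion_eq_of_smul_eq_of_ne_zero_of_mem_absUpperRamificationSubgroup`,
`SwanConductorTorsionDichotomyProofs`; Silverman *ATAEC* p. 370).  So above `2` the wild part of
`ℚ(E[3])` for these curves is that of `ℚ(√k)`.
[cite: SilvermanATAEC1994, proof of Thm. IV.11.1 for p = 3 (PDF p. 370)]
[cite: SilvermanAEC2009, X.6 (the curves y² = x³ + D)] -/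
theorem forall_smul_geomTorsion_three_eq_iff_of_sq_eq [W.IsElliptic] (h₁ : W.a₁ = 0)
    (h₂ : W.a₂ = 0) (h₃ : W.a₃ = 0) (h₄ : W.a₄ = 0) {s : AlgebraicClosure K}
    (hs : s ^ 2 = algebraMap K (AlgebraicClosure K) W.a₆) (hs0 : s ≠ 0)
    {v : HeightOneSpectrum (𝓞 K)} (h3 : ((3 : ℕ) : 𝓞 K) ∉ v.asIdeal)
    {𝔓 : Ideal (absIntegers (𝓞 K) K)} (h𝔓 : 𝔓 ∈ v.primesAbove) {u : ℝ} (hu : 0 < u) :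
    (∀ σ ∈ absUpperRamificationSubgroup (𝓞 K) 𝔓 u, ∀ T : geomTorsion W (3 : ℕ), σ • T = T) ↔
      ∀ σ ∈ absUpperRamificationSubgroup (𝓞 K) 𝔓 u, σ • s = s := by
  obtain ⟨P, hP0, h3P, hiff⟩ :=
    W.exists_geomPoints_three_torsion_of_sq_eq h₁ h₂ h₃ h₄ two_ne_zero hs hs0
  have hmem : P ∈ geomTorsion W (3 : ℕ) := AddSubgroup.torsionBy.nsmul_iff.mpr h3P
  set T₀ : geomTorsion W (3 : ℕ) := ⟨P, hmem⟩ with hT₀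
  have hT₀0 : T₀ ≠ 0 := fun h ↦ hP0 (congrArg Subtype.val h)
  constructor
  · intro H σ hσ
    exact (hiff σ).mp (congrArg Subtype.val (H σ hσ T₀))
  · intro H
    exact W.forall_smul_geomTorsion_eq_of_smul_eq_of_ne_zero_of_mem_absUpperRamificationSubgroup
      3 h3 h𝔓 hu hT₀0 fun σ hσ ↦ Subtype.ext ((hiff σ).mpr (H σ hσ))

/-- **`Sw_𝔓(V₃ E) = 2 · vol {u > 0 : Γ_K^u(𝔓) moves √k}` for `y² = x³ + k` over a number
field** (`𝔓 ∣ v ∤ 3`): the Swan conductor is twice the measure of the set of `u > 0` at which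
`Γ^u` moves `E[3]` (`swanConductorAt_rationalTate_eq_two_mul_volume`), and `Γ^u` moves `E[3]`
iff it moves `√k`.  In particular above `2` the wild conductor of `y² = x³ + k` is twice the
upper break of `K(√k)`: `δ(E) = 2δ(χ_k)`.
[cite: SilvermanATAEC1994, §IV.10 Definition of δ (PDF p. 358) and proof of Thm. IV.11.1, p. 370]
[cite: SerreLocalFields1979, Ch. IV §3 and Ch. VI §2] -/
theorem swanConductorAt_rationalTate_three_eq_two_mul_volume_of_sq_eq [W.IsElliptic]
    (h₁ : W.a₁ = 0) (h₂ : W.a₂ = 0) (h₃ : W.a₃ = 0) (h₄ : W.a₄ = 0) {s : AlgebraicClosure K}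
    (hs : s ^ 2 = algebraMap K (AlgebraicClosure K) W.a₆) (hs0 : s ≠ 0)
    (h : Continuous fun x : absoluteGaloisGroup K × RationalTateModule (geomPoints W) 3 ↦
      rationalTateRepresentation (absoluteGaloisGroup K) (geomPoints W) 3 x.1 x.2)
    {v : HeightOneSpectrum (𝓞 K)} (h3 : ((3 : ℕ) : 𝓞 K) ∉ v.asIdeal)
    {𝔓 : Ideal (absIntegers (𝓞 K) K)} (h𝔓 : 𝔓 ∈ v.primesAbove) :
    (rationalTateGaloisRepOf (geomPoints W) 3 h).swanConductorAt (𝓞 K) 𝔓 =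
      2 * MeasureTheory.volume.real {u : ℝ | 0 < u ∧
        ∃ σ ∈ absUpperRamificationSubgroup (𝓞 K) 𝔓 u, σ • s ≠ s} := by
  rw [W.swanConductorAt_rationalTate_eq_two_mul_volume 3 h h3 h𝔓]
  congr 2
  ext u
  simp only [Set.mem_setOf_eq]
  refine and_congr_right fun hu ↦ ?_
  have key := W.forall_smul_geomTorsion_three_eq_iff_of_sq_eq h₁ h₂ h₃ h₄ hs hs0 h3 h𝔓 hu
  constructor
  · rintro ⟨σ, hσ, T, hT⟩
    by_contra hno
    push Not at hno
    exact hT (key.mpr hno σ hσ T)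
  · rintro ⟨σ, hσ, hne⟩
    by_contra hno
    push Not at hno
    exact hne (key.mp hno σ hσ)

variable (ℓ : ℕ) [Fact ℓ.Prime]

/-- **`Sw_𝔓(V_ℓ E) = 2 · vol {u > 0 : Γ_K^u(𝔓) moves √k}` for `y² = x³ + k`, every `ℓ` with
`v ∤ 3ℓ`** — by the independence of `ℓ` of the Swan conductor
(`swanConductorAt_rationalTate_eq_swanConductorAt_rationalTate`, Silverman *ATAEC* Thm. IV.10.2(c)
at every place, `HasseWeilAbelianConductorSwanIndependenceTwoProofs`) and the case `ℓ = 3`.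
[cite: SilvermanATAEC1994, Thm. IV.10.2(c) (PDF p. 358) and §IV.10 Definition of δ] -/
theorem swanConductorAt_rationalTate_eq_two_mul_volume_of_sq_eq [W.IsElliptic]
    (h₁ : W.a₁ = 0) (h₂ : W.a₂ = 0) (h₃ : W.a₃ = 0) (h₄ : W.a₄ = 0) {s : AlgebraicClosure K}
    (hs : s ^ 2 = algebraMap K (AlgebraicClosure K) W.a₆) (hs0 : s ≠ 0)
    (h : Continuous fun x : absoluteGaloisGroup K × RationalTateModule (geomPoints W) ℓ ↦
      rationalTateRepresentation (absoluteGaloisGroup K) (geomPoints W) ℓ x.1 x.2)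
    {v : HeightOneSpectrum (𝓞 K)} (hℓ : (ℓ : 𝓞 K) ∉ v.asIdeal) (h3 : ((3 : ℕ) : 𝓞 K) ∉ v.asIdeal)
    {𝔓 : Ideal (absIntegers (𝓞 K) K)} (h𝔓 : 𝔓 ∈ v.primesAbove) :
    (rationalTateGaloisRepOf (geomPoints W) ℓ h).swanConductorAt (𝓞 K) 𝔓 =
      2 * MeasureTheory.volume.real {u : ℝ | 0 < u ∧
        ∃ σ ∈ absUpperRamificationSubgroup (𝓞 K) 𝔓 u, σ • s ≠ s} := by
  rw [W.swanConductorAt_rationalTate_eq_swanConductorAt_rationalTate ℓ 3 h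
    (W.continuous_rationalGaloisRepTate_holds 3) hℓ h3 h𝔓]
  exact W.swanConductorAt_rationalTate_three_eq_two_mul_volume_of_sq_eq h₁ h₂ h₃ h₄ hs hs0 _ h3 h𝔓

end NumberField

/-! ## §3. Over `ℚ` above `2`: `Sw = 0, 2, 4` for `k = c²k₀`, `k₀ ≡ 1, 3, 2 (mod 4)` -/

section Rat

open Rat.HeightOneSpectrum

variable (W : WeierstrassCurve ℚ) (ℓ : ℕ) [Fact ℓ.Prime]

/-- **The wild conductor at `2` of `y² = x³ + c²k₀` over `ℚ` is `2 · vol {u > 0 : Γ^u moves √k₀}`**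
(`c ∈ ℚ^×`, `k₀ ∈ ℤ ∖ 0`; every `k ∈ ℚ^×` is of this form with `4 ∤ k₀`): `s = c√k₀` has
`s² = k` and is moved by `σ` exactly when `√k₀` is.
[cite: SilvermanATAEC1994, §IV.10 Definition of δ (PDF p. 358) and proof of Thm. IV.11.1, p. 370] -/
theorem swanConductorAt_rationalTate_eq_two_mul_volume_of_a₆_eq_sq_mul [W.IsElliptic]
    (h₁ : W.a₁ = 0) (h₂ : W.a₂ = 0) (h₃ : W.a₃ = 0) (h₄ : W.a₄ = 0) {c : ℚ} (hc : c ≠ 0)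
    {k₀ : ℤ} (hk₀ : k₀ ≠ 0) (ha₆ : W.a₆ = c ^ 2 * k₀)
    (h : Continuous fun x : absoluteGaloisGroup ℚ × RationalTateModule (geomPoints W) ℓ ↦
      rationalTateRepresentation (absoluteGaloisGroup ℚ) (geomPoints W) ℓ x.1 x.2)
    {v : HeightOneSpectrum (𝓞 ℚ)} (hv : (2 : 𝓞 ℚ) ∈ v.asIdeal) (hℓ : (ℓ : 𝓞 ℚ) ∉ v.asIdeal)
    {𝔓 : Ideal (absIntegers (𝓞 ℚ) ℚ)} (h𝔓 : 𝔓 ∈ v.primesAbove) :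
    (rationalTateGaloisRepOf (geomPoints W) ℓ h).swanConductorAt (𝓞 ℚ) 𝔓 =
      2 * MeasureTheory.volume.real {u : ℝ | 0 < u ∧
        ∃ σ ∈ absUpperRamificationSubgroup (𝓞 ℚ) 𝔓 u,
          σ • geomSqrt (k₀ : ℚ) ≠ geomSqrt (k₀ : ℚ)} := by
  set s : AlgebraicClosure ℚ := (c : AlgebraicClosure ℚ) * geomSqrt (k₀ : ℚ) with hs_def
  have hs : s ^ 2 = algebraMap ℚ (AlgebraicClosure ℚ) W.a₆ := by
    rw [eq_ratCast, ha₆, hs_def, mul_pow, geomSqrt_sq, eq_ratCast]; push_cast; ring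
  have hc' : (c : AlgebraicClosure ℚ) ≠ 0 := by exact_mod_cast hc
  have hs0 : s ≠ 0 :=
    mul_ne_zero hc' (geomSqrt_ne_zero (by exact_mod_cast hk₀))
  have hσs : ∀ σ : absoluteGaloisGroup ℚ,
      σ • s = (c : AlgebraicClosure ℚ) * σ • geomSqrt (k₀ : ℚ) := fun σ ↦ by
    change absoluteGaloisGroup.toAlgEquiv ℚ σ s = _ * absoluteGaloisGroup.toAlgEquiv ℚ σ _
    rw [hs_def, map_mul, map_ratCast]
  rw [W.swanConductorAt_rationalTate_eq_two_mul_volume_of_sq_eq ℓ h₁ h₂ h₃ h₄ hs hs0 h hℓ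
    (three_notMem_of_two_mem hv) h𝔓]
  congr 2
  ext u
  simp only [Set.mem_setOf_eq]
  refine and_congr_right fun _ ↦ ?_
  refine exists_congr fun σ ↦ and_congr_right fun _ ↦ ?_
  rw [hσs σ]
  exact (mul_right_injective₀ hc').ne_iff

/-- **`Sw₂(V_ℓ E) = 0` for `y² = x³ + c²k₀`, `k₀ ≡ 1 (mod 4)`** (`ℚ(√k₀)` unramified at `2`,
`Rat.volume_real_setOf_smul_sqrt_ne_of_emod_four_eq_one`): `δ₂(E) = 2δ₂(χ_{k₀}) = 0`.
[cite: SilvermanATAEC1994, §IV.10 Definition of δ (PDF p. 358), Thm. IV.11.1 at p = 2 (p. 366)]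
[cite: SerreLocalFields1979, Ch. IV §3, Ch. VI §2] -/
theorem swanConductorAt_rationalTate_eq_zero_of_a₆_eq_sq_mul_of_emod_four_eq_one [W.IsElliptic]
    (h₁ : W.a₁ = 0) (h₂ : W.a₂ = 0) (h₃ : W.a₃ = 0) (h₄ : W.a₄ = 0) {c : ℚ} (hc : c ≠ 0)
    {k₀ : ℤ} (hk₀ : k₀ % 4 = 1) (ha₆ : W.a₆ = c ^ 2 * k₀)
    (h : Continuous fun x : absoluteGaloisGroup ℚ × RationalTateModule (geomPoints W) ℓ ↦
      rationalTateRepresentation (absoluteGaloisGroup ℚ) (geomPoints W) ℓ x.1 x.2)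
    {v : HeightOneSpectrum (𝓞 ℚ)} (hv : (2 : 𝓞 ℚ) ∈ v.asIdeal) (hℓ : (ℓ : 𝓞 ℚ) ∉ v.asIdeal)
    {𝔓 : Ideal (absIntegers (𝓞 ℚ) ℚ)} (h𝔓 : 𝔓 ∈ v.primesAbove) :
    (rationalTateGaloisRepOf (geomPoints W) ℓ h).swanConductorAt (𝓞 ℚ) 𝔓 = 0 := by
  rw [W.swanConductorAt_rationalTate_eq_two_mul_volume_of_a₆_eq_sq_mul ℓ h₁ h₂ h₃ h₄ hc (by omega)
    ha₆ h hv hℓ h𝔓, Rat.volume_real_setOf_smul_sqrt_ne_of_emod_four_eq_one hk₀ hv h𝔓, mul_zero]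

/-- **`Sw₂(V_ℓ E) = 2` for `y² = x³ + c²k₀`, `k₀ ≡ 3 (mod 4)`** (the break of `ℚ₂(√k₀)` is `1`,
`Rat.volume_real_setOf_smul_sqrt_ne_of_emod_four_eq_three`): `δ₂(E) = 2δ₂(χ_{k₀}) = 2`.
[cite: SilvermanATAEC1994, §IV.10 Definition of δ (PDF p. 358), Thm. IV.11.1 at p = 2 (p. 366)]
[cite: SerreLocalFields1979, Ch. IV §3, Ch. VI §2] -/
theorem swanConductorAt_rationalTate_eq_two_of_a₆_eq_sq_mul_of_emod_four_eq_three [W.IsElliptic]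
    (h₁ : W.a₁ = 0) (h₂ : W.a₂ = 0) (h₃ : W.a₃ = 0) (h₄ : W.a₄ = 0) {c : ℚ} (hc : c ≠ 0)
    {k₀ : ℤ} (hk₀ : k₀ % 4 = 3) (ha₆ : W.a₆ = c ^ 2 * k₀)
    (h : Continuous fun x : absoluteGaloisGroup ℚ × RationalTateModule (geomPoints W) ℓ ↦
      rationalTateRepresentation (absoluteGaloisGroup ℚ) (geomPoints W) ℓ x.1 x.2)
    {v : HeightOneSpectrum (𝓞 ℚ)} (hv : (2 : 𝓞 ℚ) ∈ v.asIdeal) (hℓ : (ℓ : 𝓞 ℚ) ∉ v.asIdeal)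
    {𝔓 : Ideal (absIntegers (𝓞 ℚ) ℚ)} (h𝔓 : 𝔓 ∈ v.primesAbove) :
    (rationalTateGaloisRepOf (geomPoints W) ℓ h).swanConductorAt (𝓞 ℚ) 𝔓 = 2 := by
  rw [W.swanConductorAt_rationalTate_eq_two_mul_volume_of_a₆_eq_sq_mul ℓ h₁ h₂ h₃ h₄ hc (by omega)
    ha₆ h hv hℓ h𝔓, Rat.volume_real_setOf_smul_sqrt_ne_of_emod_four_eq_three hk₀ (geomSqrt_sq _)
    hv h𝔓, mul_one]

/-- **`Sw₂(V_ℓ E) = 4` for `y² = x³ + c²k₀`, `k₀ ≡ 2 (mod 4)`** (the break of `ℚ₂(√k₀)` is `2`,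
`Rat.volume_real_setOf_smul_sqrt_ne_of_emod_four_eq_two`): `δ₂(E) = 2δ₂(χ_{k₀}) = 4`.
[cite: SilvermanATAEC1994, §IV.10 Definition of δ (PDF p. 358), Thm. IV.11.1 at p = 2 (p. 366)]
[cite: SerreLocalFields1979, Ch. IV §3, Ch. VI §2] -/
theorem swanConductorAt_rationalTate_eq_four_of_a₆_eq_sq_mul_of_emod_four_eq_two [W.IsElliptic]
    (h₁ : W.a₁ = 0) (h₂ : W.a₂ = 0) (h₃ : W.a₃ = 0) (h₄ : W.a₄ = 0) {c : ℚ} (hc : c ≠ 0)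
    {k₀ : ℤ} (hk₀ : k₀ % 4 = 2) (ha₆ : W.a₆ = c ^ 2 * k₀)
    (h : Continuous fun x : absoluteGaloisGroup ℚ × RationalTateModule (geomPoints W) ℓ ↦
      rationalTateRepresentation (absoluteGaloisGroup ℚ) (geomPoints W) ℓ x.1 x.2)
    {v : HeightOneSpectrum (𝓞 ℚ)} (hv : (2 : 𝓞 ℚ) ∈ v.asIdeal) (hℓ : (ℓ : 𝓞 ℚ) ∉ v.asIdeal)
    {𝔓 : Ideal (absIntegers (𝓞 ℚ) ℚ)} (h𝔓 : 𝔓 ∈ v.primesAbove) :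
    (rationalTateGaloisRepOf (geomPoints W) ℓ h).swanConductorAt (𝓞 ℚ) 𝔓 = 4 := by
  rw [W.swanConductorAt_rationalTate_eq_two_mul_volume_of_a₆_eq_sq_mul ℓ h₁ h₂ h₃ h₄ hc (by omega)
    ha₆ h hv hℓ h𝔓, Rat.volume_real_setOf_smul_sqrt_ne_of_emod_four_eq_two hk₀ (geomSqrt_sq _)
    hv h𝔓]
  norm_num

end Rat

end WeierstrassCurve

end
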